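import Literature.MathematicalPhysics.QuantumFieldTheory.Balaban1983to89.T3ContinuumYM3Torus
import Literature.MathematicalPhysics.QuantumFieldTheory.Balaban1983to89.T4AvgSensitivity
import HarnessLib

/-!
# `Balaban1983to89.T3LevelShift` — the level identification between the d = 3 Wilson towers of ONE three-torus family
# ACROSS VOLUME EXPONENTS (`(m, K, j)` read as `(m′, K′, j′)` whenever `m + K − j = m′ + K′ − j′`), and its kernel-proved
# compatibility with walks, holonomies, unit-level loop representatives, product Haar measures and Bałaban's block averaging (0.4)

Cell `ym3-torus` (HUMAN RULING D-0037, YM ladder rung R3 = continuum `SU(2)` Yang–Mills on every three-torus), seat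
`ym3-torus-p2` gen 2; the d = 3 twin — and the cross-volume extension — of the tree's `T4LevelShift` (cell `pub-balaban`,
unit `b2b-balaban-t4-lean`), on which it is modelled declaration by declaration.

HONEST FRAMING.  ELEMENTARY LATTICE BOOKKEEPING about the tree's own typed objects; every theorem is a finite combinatorial
identity (or its push-forward under the product Haar measure); the `[cite:]` tags only LOCATE the printed formula the identity
is ABOUT (never a printed theorem) ((0.1) p. 251, (0.4) p. 253, (0.11) p. 253 of [Balaban1987RG1]; (1)–(3) p. 256 of
[Balaban1985UV3]), all quoted verbatim in certified headers already in the tree (`Setup`, `T4Continuum`, `BlockAveraging`,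
`T3ContinuumYM3Torus`).  NO sentence of Bałaban's series is newly quoted; NO printed estimate, bound or convergence statement is
asserted or used.  Not d = 4, not infinite volume, not a mass gap, not summit progress.

## Why (the node's N9 «threshold removal by superrenormalisable scaling», `T3ContinuumYM3Torus` §8)

`T3ContinuumYM3Torus.T3Family.refine n` replaces the volume exponent `m` by `m + n` at the same block size `L`: the PAIR
`(m, γ)` and the REFINED pair `(m + n, γL^{-n})` describe the same physical torus, the `K`-th lattice of the refined family IS the
`(K+n)`-th lattice of the original with the same Wilson weight (`refine_sitesPerDir`, `refine_β`, in the tree), and the original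
family's unit-scale averaged loop variables are functions of the refined family's unit field through `n` further (0.4)-averagings.
In the tree the two towers are DIFFERENT `Setup.Params` records — `params3 L hL m (K+n)` and `params3 L hL (m+n) K` — whose
level-`j` site types `Fin 3 → ZMod (2·L^{m+(K+n)−j})` and `Fin 3 → ZMod (2·L^{(m+n)+K−j})` have EQUAL MODULI but are not one
type.  `T4LevelShift` supplies exactly this identification for the cone's `T4Family` — but only WITHIN one family (`d = 4`, `m`
shared by all runs, its header (b)).  This LOW leaf (imports `T3ContinuumYM3Torus` and `T4AvgSensitivity` only; ADDITIVE — no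
existing module is modified) supplies it for the two-parameter family `T3Family.PP F m K := params3 F.L F.hL m K` of ALL d = 3 towers of block
size `F.L` (so `F.P K = F.PP F.m K` and `(F.refine n).P K = F.PP (F.m + n) K`, both `rfl`), dimension `3` and block size `F.L`
agreeing across the family by `rfl` (no cast of `Fin d`, no reindexing of (0.4)'s index set `BlockAveraging.Idx`).

## What this file adds (and only this)

§1 THE IDENTIFICATION KIT: `T3Family.PP`, `sitesPerDir_eq` (`m + K + j′ = m′ + K′ + j ⇒` equal moduli); for a modulus
   equality `h`, `coordEquiv h` (`ZMod.ringEquivCongr`), `siteShift h : Site (F.PP m K) j ≃ Site (F.PP m′ K′) j′`, `bondShift h`,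
   `stepShift h`; commutation with `Site.shift`/`unshift`, bond targets, `emb`, `blockOf`, the unit labels `T3Family.toLevel`,
   the walks of `T4Continuum` and their endpoints, the unit-level representatives `UWord3.atLevel`; coherence.
§2 FIELDS: `fieldShift h V := V ∘ bondShift h` (contravariant), coherence, inverse, measurability, preservation of the product
   Haar measure (`measurePreserving_fieldShift`, `integral_comp_fieldShift`).
§3 HOLONOMIES, LOOPS, PLAQUETTES, THE WILSON ACTION: `holAt (fieldShift h V) γ = holAt V (γ.map (stepShift h))`, `loopAt`, at
   matching unit levels `loopAt (fieldShift h V) (C.atLevel K) = loopAt V (C.atLevel K′)`; gauge transformations; `plaqShift h`,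
   `plaqHol_fieldShift`, `wilsonAction_fieldShift` (level `0`: the Wilson weights of the two towers are ONE function).
§4 (0.4): `axialAvg`, `loopHol`, the small-field guard, `corr`, `avgFun`, `blockAvg_fieldShift` for EVERY small-loop average `ℰ`;
   ITERATED: `iter_fieldShift` (two towers with all levels matched, `m + K = m′ + K′`) and `iterFrom_fieldShift` (levels
   `k₀ + i` of one tower = levels `i` of a shorter one, `m + K = m₂ + K₂ + k₀`).
§5 THE UNIT MAP of a d = 3 family: `unitShift F K : GaugeField (F.P K) K G → GaugeField (F.P 0) 0 G` (every approximation's unit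
   lattice read on `T3Family.USite`), `loopAt_unitShift`, measurability, measure preservation, and the factorisation of the
   node's observables through the unit field: `T3Family.avgObs_eq_loopAt_unitShift`.

WHAT IS NOT PROVED / VALUE.  Nothing analytic; no statement about densities, laws, rates or limits.  VALUE = the kernel
bookkeeping the N9 transfer (`T3ThresholdRemoval`, same seat) consumes: the refined scheme's `K`-th expectation and the original
scheme's `(K+n)`-th expectation become integrals over ONE unit-field space.  NOT summit progress.

Upstream: `T3ContinuumYM3Torus` (hence `BlockAveraging`, `AveragingRT`, `T4Continuum`, `Setup`, `Balaban1985CMP102.Setting`),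
`T4AvgSensitivity` (`iterFrom`, `iter_add`).
-/

noncomputable section

open MeasureTheory
open Literature.MathematicalPhysics.QuantumFieldTheory.Balaban1983to89.T3ContinuumYM3Torus

/-! ## §0 The two-parameter family of d = 3 towers of one `T3Family` -/

namespace Literature.MathematicalPhysics.QuantumFieldTheory.Balaban1983to89.T3ContinuumYM3Torus.T3Family

variable (F : T3Family)

/-- THE TWO-PARAMETER FAMILY OF d = 3 TOWERS of block size `F.L`: volume exponent `m`, `K` renormalisation steps (tree
`params3`; `F.P K = F.PP F.m K` and `(F.refine n).P K = F.PP (F.m + n) K`, both `rfl`).  Level `j` has `2·L^{m+K−j}` sites per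
direction ([Balaban1985UV3] (1)–(3) p. 256 / [Balaban1987RG1] (0.1) p. 251 with `ε ↦ L^j ε`). [cite: Balaban1985UV3, (1)-(3) p.256] -/
def PP (m K : ℕ) : Params := Balaban1985CMP102.Setting.params3 F.L F.hL m K

/-- Its dimension is `3`. [cite: Balaban1985UV3, (1)-(3) p.256] -/
@[simp] theorem PP_d (m K : ℕ) : (F.PP m K).d = 3 := rfl

/-- Its block size is `L`. [cite: Balaban1985UV3, (1)-(3) p.256] -/
@[simp] theorem PP_L (m K : ℕ) : (F.PP m K).L = F.L := rfl

/-- Its volume exponent is `m`. [cite: Balaban1985UV3, (1)-(3) p.256] -/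
@[simp] theorem PP_m (m K : ℕ) : (F.PP m K).m = m := rfl

/-- Its number of steps is `K`. [cite: Balaban1985UV3, (1)-(3) p.256] -/
@[simp] theorem PP_K (m K : ℕ) : (F.PP m K).K = K := rfl

/-- The node's `K`-th approximation is the tower `(F.m, K)` (definitional). [cite: Balaban1985UV3, (1)-(3) p.256] -/
theorem P_eq_PP (K : ℕ) : F.P K = F.PP F.m K := rfl

/-- The refined family's `K`-th approximation is the tower `(F.m + n, K)` (definitional). [cite: Balaban1985UV3, (1)-(3) p.256] -/
theorem refine_P_eq_PP (n K : ℕ) : (F.refine n).P K = F.PP (F.m + n) K := rfl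

/-- Refinement does not change the two-parameter family (same `L`; definitional). [cite: Balaban1985UV3, (1)-(3) p.256] -/
theorem refine_PP (n m K : ℕ) : (F.refine n).PP m K = F.PP m K := rfl

/-- Sites per direction of level `j` of the tower `(m, K)`: `2·L^{m+K−j}`. [cite: Balaban1987RG1, (0.1) p.251] -/
theorem sitesPerDir_PP (m K j : ℕ) : (F.PP m K).sitesPerDir j = 2 * F.L ^ (m + K - j) := rfl

/-- EQUAL MODULI: level `j` of the tower `(m, K)` and level `j′` of the tower `(m′, K′)` have the same number of sites per
direction whenever `m + K − j = m′ + K′ − j′` (stated additively). [cite: Balaban1987RG1, (0.1) p.251] -/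
theorem sitesPerDir_eq {m K j m' K' j' : ℕ} (h : m + K + j' = m' + K' + j) :
    (F.PP m K).sitesPerDir j = (F.PP m' K').sitesPerDir j' := by
  rw [sitesPerDir_PP, sitesPerDir_PP]
  congr 2
  omega

/-- The unit lattices of all approximations of one family have `2·L^m` sites per direction: level `0` of `F.P 0` and level `K`
of `F.P K`. [cite: Balaban1987RG1, (0.1) p.251] -/
theorem sitesPerDir_unit (K : ℕ) : (F.PP F.m 0).sitesPerDir 0 = (F.PP F.m K).sitesPerDir K :=
  F.sitesPerDir_eq (by omega)

end Literature.MathematicalPhysics.QuantumFieldTheory.Balaban1983to89.T3ContinuumYM3Torus.T3Family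

namespace Literature.MathematicalPhysics.QuantumFieldTheory.Balaban1983to89.T3LevelShift

open T4Continuum

/-! ## §1 The identification kit: coordinates, sites, bonds, steps, walks -/

section Kit

variable {F : T3Family} {m K j m' K' j' : ℕ}

/-- The coordinate rings `ZMod n`, `ZMod n′` along `n = n′`: `ZMod.ringEquivCongr` (as `T3Family.siteEquiv`). [folklore] -/
def coordEquiv (h : (F.PP m K).sitesPerDir j = (F.PP m' K').sitesPerDir j') :
    ZMod ((F.PP m K).sitesPerDir j) ≃+* ZMod ((F.PP m' K').sitesPerDir j') :=
  ZMod.ringEquivCongr h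

/-- `coordEquiv` preserves the canonical representative. [cite: Balaban1987RG1, (0.1) p.251] -/
@[simp] theorem coordEquiv_val (h : (F.PP m K).sitesPerDir j = (F.PP m' K').sitesPerDir j')
    (z : ZMod ((F.PP m K).sitesPerDir j)) : (coordEquiv h z).val = z.val :=
  ZMod.ringEquivCongr_val h z

/-- `coordEquiv` fixes the casts of naturals. [cite: Balaban1987RG1, (0.1) p.251] -/
theorem coordEquiv_natCast (h : (F.PP m K).sitesPerDir j = (F.PP m' K').sitesPerDir j') (n : ℕ) :
    coordEquiv h (n : ZMod ((F.PP m K).sitesPerDir j)) = n :=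
  map_natCast (coordEquiv h) n

/-- `coordEquiv` fixes the casts of integers. [cite: Balaban1987RG1, (0.1) p.251] -/
theorem coordEquiv_intCast (h : (F.PP m K).sitesPerDir j = (F.PP m' K').sitesPerDir j') (n : ℤ) :
    coordEquiv h (n : ZMod ((F.PP m K).sitesPerDir j)) = n :=
  map_intCast (coordEquiv h) n

/-- **THE LEVEL IDENTIFICATION OF SITES**: level `j` of the tower `(m, K)` ≃ level `j′` of the tower `(m′, K′)` along equal moduli,
coordinate by coordinate. [cite: Balaban1987RG1, (0.1) p.251] -/
def siteShift (h : (F.PP m K).sitesPerDir j = (F.PP m' K').sitesPerDir j') : Site (F.PP m K) j ≃ Site (F.PP m' K') j' where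
  toFun x ν := coordEquiv h (x ν)
  invFun y ν := (coordEquiv h).symm (y ν)
  left_inv x := by
    funext ν
    exact (coordEquiv h).symm_apply_apply _
  right_inv y := by
    funext ν
    exact (coordEquiv h).apply_symm_apply _

/-- [cite: Balaban1987RG1, (0.1) p.251] -/
@[simp] theorem siteShift_apply (h : (F.PP m K).sitesPerDir j = (F.PP m' K').sitesPerDir j') (x : Site (F.PP m K) j)
    (ν : Fin 3) : siteShift h x ν = coordEquiv h (x ν) :=
  rfl

/-- The identification commutes with the unit steps `x ↦ x + e_μ`. [cite: Balaban1987RG1, (0.1) p.251] -/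
theorem siteShift_shift (h : (F.PP m K).sitesPerDir j = (F.PP m' K').sitesPerDir j') (x : Site (F.PP m K) j) (μ : Fin 3) :
    siteShift h (x.shift μ) = (siteShift h x).shift μ := by
  show (⇑(coordEquiv h) ∘ Function.update x μ (x μ + 1) : Fin (F.PP m K).d → ZMod ((F.PP m' K').sitesPerDir j')) =
    Function.update (⇑(coordEquiv h) ∘ x) μ (coordEquiv h (x μ) + 1)
  rw [Function.comp_update, map_add, map_one]

/-- The identification commutes with the unit steps `x ↦ x − e_μ`. [cite: Balaban1987RG1, (0.1) p.251] -/
theorem siteShift_unshift (h : (F.PP m K).sitesPerDir j = (F.PP m' K').sitesPerDir j') (x : Site (F.PP m K) j) (μ : Fin 3) :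
    siteShift h (x.unshift μ) = (siteShift h x).unshift μ := by
  show (⇑(coordEquiv h) ∘ Function.update x μ (x μ - 1) : Fin (F.PP m K).d → ZMod ((F.PP m' K').sitesPerDir j')) =
    Function.update (⇑(coordEquiv h) ∘ x) μ (coordEquiv h (x μ) - 1)
  rw [Function.comp_update, map_sub, map_one]

/-- Coherence: along a trivial modulus equality the identification is the identity. [cite: Balaban1987RG1, (0.1) p.251] -/
theorem siteShift_refl (h : (F.PP m K).sitesPerDir j = (F.PP m K).sitesPerDir j) (x : Site (F.PP m K) j) :
    siteShift h x = x := by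
  funext ν
  apply ZMod.val_injective
  simp only [siteShift_apply, coordEquiv_val]

/-- Coherence: identifications compose. [cite: Balaban1987RG1, (0.1) p.251] -/
theorem siteShift_siteShift {m'' K'' j'' : ℕ} (h : (F.PP m K).sitesPerDir j = (F.PP m' K').sitesPerDir j')
    (h' : (F.PP m' K').sitesPerDir j' = (F.PP m'' K'').sitesPerDir j'') (x : Site (F.PP m K) j) :
    siteShift h' (siteShift h x) = siteShift (h.trans h') x := by
  funext ν
  apply ZMod.val_injective
  simp only [siteShift_apply, coordEquiv_val]

/-- The identification commutes with the EMBEDDING OF BLOCK CENTRES `emb : T^{(j+1)} → T^{(j)}` (`y ↦ L·y + (L−1)/2`), the two level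
pairs `(j, j′)` and `(j+1, j′+1)` being matched (`h₀`, `h₁`). [cite: Balaban1987RG1, (0.4) p.253] -/
theorem siteShift_emb (h₀ : (F.PP m K).sitesPerDir j = (F.PP m' K').sitesPerDir j')
    (h₁ : (F.PP m K).sitesPerDir (j + 1) = (F.PP m' K').sitesPerDir (j' + 1)) (y : Site (F.PP m K) (j + 1)) :
    siteShift h₀ (emb y) = emb (siteShift h₁ y) := by
  funext ν
  simp only [siteShift_apply, emb, coordEquiv_natCast, coordEquiv_val, T3Family.PP_L]

/-- The identification commutes with the block map `x ↦ blockOf x` (`⌊x_μ / L⌋`). [cite: Balaban1987RG1, (0.4) p.253] -/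
theorem siteShift_blockOf (h₀ : (F.PP m K).sitesPerDir j = (F.PP m' K').sitesPerDir j')
    (h₁ : (F.PP m K).sitesPerDir (j + 1) = (F.PP m' K').sitesPerDir (j' + 1)) (x : Site (F.PP m K) j) :
    siteShift h₁ (blockOf x) = blockOf (siteShift h₀ x) := by
  funext ν
  simp only [siteShift_apply, blockOf, coordEquiv_natCast, coordEquiv_val, T3Family.PP_L]

/-- The unit labels `toLevel K x` have the representatives of `x` as coordinates. [cite: Balaban1987RG1, (0.1) p.251] -/
theorem val_toLevel (K : ℕ) (x : F.USite) (ν : Fin 3) : (F.toLevel K x ν).val = (x ν).val :=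
  ZMod.ringEquivCongr_val _ _

/-- At the UNIT levels of ONE family the identification carries the labels `T3Family.toLevel K x` to `toLevel K′ x`
(`x : USite`): the unit lattices of all approximations are one lattice (`T3Family.siteEquiv`). [cite: Balaban1987RG1, (0.1) p.251] -/
theorem siteShift_toLevel {K K' : ℕ} (h : (F.PP F.m K).sitesPerDir K = (F.PP F.m K').sitesPerDir K') (x : F.USite) :
    siteShift h (F.toLevel K x) = F.toLevel K' x := by
  funext ν
  apply ZMod.val_injective
  rw [siteShift_apply, coordEquiv_val]
  exact (val_toLevel K x ν).trans (val_toLevel K' x ν).symm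

/-- **THE LEVEL IDENTIFICATION OF POSITIVE BONDS** (`⟨x, μ⟩ ↦ ⟨siteShift x, μ⟩`). [folklore] -/
def bondShift (h : (F.PP m K).sitesPerDir j = (F.PP m' K').sitesPerDir j') : PBond (F.PP m K) j ≃ PBond (F.PP m' K') j' where
  toFun b := ⟨siteShift h b.src, b.dir⟩
  invFun b := ⟨(siteShift h).symm b.src, b.dir⟩
  left_inv b := by
    cases b
    simp
  right_inv b := by
    cases b
    simp

/-- [cite: Balaban1987RG1, (0.1) p.251] -/
@[simp] theorem bondShift_src (h : (F.PP m K).sitesPerDir j = (F.PP m' K').sitesPerDir j') (b : PBond (F.PP m K) j) :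
    (bondShift h b).src = siteShift h b.src :=
  rfl

/-- [cite: Balaban1987RG1, (0.1) p.251] -/
@[simp] theorem bondShift_dir (h : (F.PP m K).sitesPerDir j = (F.PP m' K').sitesPerDir j') (b : PBond (F.PP m K) j) :
    (bondShift h b).dir = b.dir :=
  rfl

/-- Bond targets correspond (`siteShift_shift`). [cite: Balaban1987RG1, (0.1) p.251] -/
theorem bondShift_tgt (h : (F.PP m K).sitesPerDir j = (F.PP m' K').sitesPerDir j') (b : PBond (F.PP m K) j) :
    (bondShift h b).tgt = siteShift h b.tgt := by
  show (siteShift h b.src).shift b.dir = siteShift h (b.src.shift b.dir)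
  rw [siteShift_shift]

/-- Coherence: bond identifications compose. [cite: Balaban1987RG1, (0.1) p.251] -/
theorem bondShift_bondShift {m'' K'' j'' : ℕ} (h : (F.PP m K).sitesPerDir j = (F.PP m' K').sitesPerDir j')
    (h' : (F.PP m' K').sitesPerDir j' = (F.PP m'' K'').sitesPerDir j'') (b : PBond (F.PP m K) j) :
    bondShift h' (bondShift h b) = bondShift (h.trans h') b := by
  show (⟨siteShift h' (siteShift h b.src), b.dir⟩ : PBond (F.PP m'' K'') j'') = ⟨siteShift (h.trans h') b.src, b.dir⟩
  rw [siteShift_siteShift]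

/-- Coherence: along a trivial modulus equality the bond identification is the identity. [cite: Balaban1987RG1, (0.1) p.251] -/
theorem bondShift_refl (h : (F.PP m K).sitesPerDir j = (F.PP m K).sitesPerDir j) (b : PBond (F.PP m K) j) :
    bondShift h b = b := by
  show (⟨siteShift h b.src, b.dir⟩ : PBond (F.PP m K) j) = b
  rw [siteShift_refl]

/-- The identification of walk steps (`T4Continuum.LStep`: a positive bond with an orientation flag). [folklore] -/
def stepShift (h : (F.PP m K).sitesPerDir j = (F.PP m' K').sitesPerDir j') (s : LStep (F.PP m K) j) : LStep (F.PP m' K') j' :=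
  ⟨bondShift h s.bond, s.fwd⟩

/-- [cite: Balaban1987RG1, (0.1) p.251] -/
@[simp] theorem stepShift_bond (h : (F.PP m K).sitesPerDir j = (F.PP m' K').sitesPerDir j') (s : LStep (F.PP m K) j) :
    (stepShift h s).bond = bondShift h s.bond :=
  rfl

/-- [cite: Balaban1987RG1, (0.1) p.251] -/
@[simp] theorem stepShift_fwd (h : (F.PP m K).sitesPerDir j = (F.PP m' K').sitesPerDir j') (s : LStep (F.PP m K) j) :
    (stepShift h s).fwd = s.fwd :=
  rfl

/-- **WALKS CORRESPOND**: the walk spelled by a word from `siteShift h x` is the image of the walk from `x`, step by step. [cite: Balaban1987RG1, (0.1) p.251] -/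
theorem walk_siteShift (h : (F.PP m K).sitesPerDir j = (F.PP m' K').sitesPerDir j') :
    ∀ (x : Site (F.PP m K) j) (w : List (Letter 3)), walk (siteShift h x) w = (walk x w).map (stepShift h)
  | _, [] => rfl
  | x, (μ, true) :: w => by
    simp only [walk, List.map_cons]
    rw [← siteShift_shift, walk_siteShift h (x.shift μ) w]
    rfl
  | x, (μ, false) :: w => by
    simp only [walk, List.map_cons]
    rw [← siteShift_unshift, walk_siteShift h (x.unshift μ) w]
    rfl

/-- Walk endpoints correspond. [cite: Balaban1987RG1, (0.1) p.251] -/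
theorem walkEnd_siteShift (h : (F.PP m K).sitesPerDir j = (F.PP m' K').sitesPerDir j') :
    ∀ (x : Site (F.PP m K) j) (w : List (Letter 3)), walkEnd (siteShift h x) w = siteShift h (walkEnd x w)
  | _, [] => rfl
  | x, (μ, true) :: w => by
    simp only [walkEnd]
    rw [← siteShift_shift, walkEnd_siteShift h (x.shift μ) w]
  | x, (μ, false) :: w => by
    simp only [walkEnd]
    rw [← siteShift_unshift, walkEnd_siteShift h (x.unshift μ) w]

/-- At matching UNIT levels `(K, K)`, `(K′, K′)` of ONE family the level-`K` representative of a unit-lattice word is carried to the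
level-`K′` representative: `(C.atLevel K).map (stepShift h) = C.atLevel K′`. [cite: Balaban1987RG1, (0.1) p.251] -/
theorem map_stepShift_atLevel {K K' : ℕ} (h : (F.PP F.m K).sitesPerDir K = (F.PP F.m K').sitesPerDir K') (C : UWord3 F) :
    (C.atLevel K).map (stepShift h) = C.atLevel K' := by
  show (walk (P := F.PP F.m K) (F.toLevel K C.base) C.word).map (stepShift h) =
    walk (P := F.PP F.m K') (F.toLevel K' C.base) C.word
  rw [← walk_siteShift, siteShift_toLevel]

end Kit

/-! ## §2 Fields: `fieldShift h V = V ∘ bondShift h`, coherence, measurability, Haar -/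

section Fields

variable {F : T3Family} {m K j m' K' j' : ℕ} {G : Type*}

/-- **THE LEVEL IDENTIFICATION OF CONFIGURATIONS**: a configuration on level `j′` of the tower `(m′, K′)` read as one on level `j`
of the tower `(m, K)`, `(fieldShift h V)(b) = V (bondShift h b)`. [cite: Balaban1987RG1, (0.1) p.251] -/
def fieldShift (h : (F.PP m K).sitesPerDir j = (F.PP m' K').sitesPerDir j') (V : GaugeField (F.PP m' K') j' G) :
    GaugeField (F.PP m K) j G :=
  fun b => V (bondShift h b)

/-- [cite: Balaban1987RG1, (0.1) p.251] -/
@[simp] theorem fieldShift_apply (h : (F.PP m K).sitesPerDir j = (F.PP m' K').sitesPerDir j')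
    (V : GaugeField (F.PP m' K') j' G) (b : PBond (F.PP m K) j) : fieldShift h V b = V (bondShift h b) :=
  rfl

/-- Coherence: along a trivial modulus equality `fieldShift` is the identity. [cite: Balaban1987RG1, (0.1) p.251] -/
theorem fieldShift_refl (h : (F.PP m K).sitesPerDir j = (F.PP m K).sitesPerDir j) (V : GaugeField (F.PP m K) j G) :
    fieldShift h V = V := by
  funext b
  show V (bondShift h b) = V b
  rw [bondShift_refl]

/-- Coherence: `fieldShift h ∘ fieldShift h′ = fieldShift (h.trans h′)`. [cite: Balaban1987RG1, (0.1) p.251] -/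
theorem fieldShift_fieldShift {m'' K'' j'' : ℕ} (h : (F.PP m K).sitesPerDir j = (F.PP m' K').sitesPerDir j')
    (h' : (F.PP m' K').sitesPerDir j' = (F.PP m'' K'').sitesPerDir j'') (V : GaugeField (F.PP m'' K'') j'' G) :
    fieldShift h (fieldShift h' V) = fieldShift (h.trans h') V := by
  funext b
  show V (bondShift h' (bondShift h b)) = V (bondShift (h.trans h') b)
  rw [bondShift_bondShift]

/-- `fieldShift h.symm` is a right inverse of `fieldShift h`. [cite: Balaban1987RG1, (0.1) p.251] -/
theorem fieldShift_symm_fieldShift (h : (F.PP m K).sitesPerDir j = (F.PP m' K').sitesPerDir j')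
    (V : GaugeField (F.PP m K) j G) : fieldShift h (fieldShift h.symm V) = V := by
  rw [fieldShift_fieldShift, fieldShift_refl]

/-- `fieldShift h.symm` is a left inverse of `fieldShift h`. [cite: Balaban1987RG1, (0.1) p.251] -/
theorem fieldShift_fieldShift_symm (h : (F.PP m K).sitesPerDir j = (F.PP m' K').sitesPerDir j')
    (V : GaugeField (F.PP m' K') j' G) : fieldShift h.symm (fieldShift h V) = V := by
  rw [fieldShift_fieldShift, fieldShift_refl]

variable [MeasurableSpace G]

/-- `fieldShift h` is measurable (a reindexing of coordinates). [cite: Balaban1985Averaging, (10) p.19] -/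
theorem measurable_fieldShift (h : (F.PP m K).sitesPerDir j = (F.PP m' K').sitesPerDir j') :
    Measurable (fieldShift h : GaugeField (F.PP m' K') j' G → GaugeField (F.PP m K) j G) :=
  measurable_pi_lambda _ fun _ => measurable_pi_apply _

/-- [cite: Balaban1985Averaging, (10) p.19] -/
theorem piCongrLeft_bondShift_symm_apply (h : (F.PP m K).sitesPerDir j = (F.PP m' K').sitesPerDir j')
    (V : GaugeField (F.PP m' K') j' G) :
    (MeasurableEquiv.piCongrLeft (fun _ : PBond (F.PP m' K') j' => G) (bondShift h)).symm V = fieldShift h V := by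
  funext b
  rfl

variable [GaugeGroup G] [HaarData G]

/-- **THE IDENTIFICATION PRESERVES THE PRODUCT HAAR MEASURE**: `(fieldShift h)_* dV′ = dV` (`Setup.fieldMeasure`). [cite: Balaban1985Averaging, (10) p.19] -/
theorem measurePreserving_fieldShift (h : (F.PP m K).sitesPerDir j = (F.PP m' K').sitesPerDir j') :
    MeasurePreserving (fieldShift h : GaugeField (F.PP m' K') j' G → GaugeField (F.PP m K) j G)
      (fieldMeasure (F.PP m' K') j' G) (fieldMeasure (F.PP m K) j G) := by
  haveI : IsProbabilityMeasure (HaarData.haar (G := G)) := HaarData.isProb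
  have hm := (measurePreserving_piCongrLeft (fun _ : PBond (F.PP m' K') j' => (HaarData.haar : Measure G))
    (bondShift h)).symm _
  have hcoe : ⇑(MeasurableEquiv.piCongrLeft (fun _ : PBond (F.PP m' K') j' => G) (bondShift h)).symm =
      (fieldShift h : GaugeField (F.PP m' K') j' G → GaugeField (F.PP m K) j G) :=
    funext (piCongrLeft_bondShift_symm_apply h)
  rw [hcoe] at hm
  exact hm

/-- Change of variables: `∫ g (fieldShift h V) dV′ = ∫ g U dU`. [cite: Balaban1985Averaging, (10) p.19] -/
theorem integral_comp_fieldShift (h : (F.PP m K).sitesPerDir j = (F.PP m' K').sitesPerDir j')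
    (g : GaugeField (F.PP m K) j G → ℝ) :
    ∫ V, g (fieldShift h V) ∂fieldMeasure (F.PP m' K') j' G = ∫ U, g U ∂fieldMeasure (F.PP m K) j G := by
  haveI : IsProbabilityMeasure (HaarData.haar (G := G)) := HaarData.isProb
  have hm := ((measurePreserving_piCongrLeft (fun _ : PBond (F.PP m' K') j' => (HaarData.haar : Measure G))
    (bondShift h)).symm _).integral_comp' g
  simp_rw [piCongrLeft_bondShift_symm_apply h] at hm
  exact hm

end Fields

/-! ## §3 Holonomies, loop variables at the unit level, gauge transformations, plaquettes and the Wilson action -/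

section Loops

variable {F : T3Family} {m K j m' K' j' : ℕ} {G : Type*} [GaugeGroup G]

/-- **HOLONOMIES CORRESPOND**: the holonomy of `fieldShift h V` along a walk is the holonomy of `V` along the image walk. [cite: ChatterjeeYMProb2019, §2] -/
theorem holAt_fieldShift (h : (F.PP m K).sitesPerDir j = (F.PP m' K').sitesPerDir j') (V : GaugeField (F.PP m' K') j' G)
    (γ : List (LStep (F.PP m K) j)) : holAt (fieldShift h V) γ = holAt V (γ.map (stepShift h)) := by
  simp only [holAt, List.map_map]
  rfl

/-- Loop variables (`T4Continuum.loopAt`) correspond. [cite: ChatterjeeYMProb2019, §2] -/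
theorem loopAt_fieldShift (h : (F.PP m K).sitesPerDir j = (F.PP m' K').sitesPerDir j') (V : GaugeField (F.PP m' K') j' G)
    (γ : List (LStep (F.PP m K) j)) : loopAt (fieldShift h V) γ = loopAt V (γ.map (stepShift h)) := by
  rw [loopAt, loopAt, holAt_fieldShift]

/-- **UNIT-LEVEL LOOP COMPATIBILITY** within one family: at matching unit levels the loop variable of the word `C` read at level
`K` of `fieldShift h V` is its loop variable at level `K′` of `V`. [cite: Balaban1987RG1, (0.2)/(0.4) p.252] -/
theorem loopAt_fieldShift_atLevel {K K' : ℕ} (h : (F.PP F.m K).sitesPerDir K = (F.PP F.m K').sitesPerDir K')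
    (V : GaugeField (F.PP F.m K') K' G) (C : UWord3 F) :
    loopAt (fieldShift h V) (C.atLevel K) = loopAt V (C.atLevel K') := by
  rw [loopAt_fieldShift, map_stepShift_atLevel]

/-- The identification intertwines the gauge transformations (`u ↦ u ∘ siteShift h`). [cite: Balaban1985Averaging, (8) p.19] -/
theorem fieldShift_gaugeAct (h : (F.PP m K).sitesPerDir j = (F.PP m' K').sitesPerDir j') (u : GaugeTransf (F.PP m' K') j' G)
    (V : GaugeField (F.PP m' K') j' G) :
    fieldShift h (GaugeField.gaugeAct u V) = GaugeField.gaugeAct (fun x => u (siteShift h x)) (fieldShift h V) := by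
  funext b
  show u (bondShift h b).src * V (bondShift h b) * (u (bondShift h b).tgt)⁻¹ = _
  rw [bondShift_tgt]
  rfl

/-- Conversely, a gauge transformation of the source is read through the inverse site identification. [cite: Balaban1985Averaging, (8) p.19] -/
theorem gaugeAct_fieldShift (h : (F.PP m K).sitesPerDir j = (F.PP m' K').sitesPerDir j') (u : GaugeTransf (F.PP m K) j G)
    (V : GaugeField (F.PP m' K') j' G) :
    GaugeField.gaugeAct u (fieldShift h V) = fieldShift h (GaugeField.gaugeAct (fun y => u ((siteShift h).symm y)) V) := by
  rw [fieldShift_gaugeAct]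
  congr 1
  funext x
  simp

/-- **THE LEVEL IDENTIFICATION OF PLAQUETTES** (`⟨x, μ, ν⟩ ↦ ⟨siteShift x, μ, ν⟩`). [folklore] -/
def plaqShift (h : (F.PP m K).sitesPerDir j = (F.PP m' K').sitesPerDir j') : Plaq (F.PP m K) j ≃ Plaq (F.PP m' K') j' where
  toFun p := ⟨siteShift h p.src, p.μ, p.ν, p.hμν⟩
  invFun p := ⟨(siteShift h).symm p.src, p.μ, p.ν, p.hμν⟩
  left_inv p := by
    cases p
    simp
  right_inv p := by
    cases p
    simp

/-- Plaquette variables correspond: `U(∂p)` of `fieldShift h V` is `U(∂(plaqShift h p))` of `V`. [cite: Balaban1987RG1, (0.2) p.252] -/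
theorem plaqHol_fieldShift (h : (F.PP m K).sitesPerDir j = (F.PP m' K').sitesPerDir j') (V : GaugeField (F.PP m' K') j' G)
    (p : Plaq (F.PP m K) j) : GaugeField.plaqHol (fieldShift h V) p = GaugeField.plaqHol V (plaqShift h p) := by
  simp only [GaugeField.plaqHol, fieldShift_apply]
  show V ⟨siteShift h p.src, p.μ⟩ * V ⟨siteShift h (p.src.shift p.μ), p.ν⟩ * (V ⟨siteShift h (p.src.shift p.ν), p.μ⟩)⁻¹ *
      (V ⟨siteShift h p.src, p.ν⟩)⁻¹ = _
  rw [siteShift_shift, siteShift_shift]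
  rfl

/-- **THE WILSON ACTIONS OF THE TWO TOWERS ARE ONE FUNCTION**: `A^w(fieldShift h V) = A^w(V)` (reindex the plaquette sum). [cite: Balaban1987RG1, (0.2) p.252] -/
theorem wilsonAction_fieldShift (h : (F.PP m K).sitesPerDir j = (F.PP m' K').sitesPerDir j') (w : ℝ)
    (V : GaugeField (F.PP m' K') j' G) : wilsonAction w (fieldShift h V) = wilsonAction w V := by
  unfold wilsonAction
  simp_rw [plaqHol_fieldShift h V]
  exact (plaqShift h).sum_comp (fun q => w * (1 - reTr (GaugeField.plaqHol V q)))

/-- In particular for the unit-weight action `wilsonAction4` entering the Gibbs weights of the schemes. [cite: Balaban1987RG1, (0.2) p.252] -/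
theorem wilsonAction4_fieldShift (h : (F.PP m K).sitesPerDir j = (F.PP m' K').sitesPerDir j')
    (V : GaugeField (F.PP m' K') j' G) : wilsonAction4 (fieldShift h V) = wilsonAction4 V :=
  wilsonAction_fieldShift h 1 V

end Loops

/-! ## §4 Bałaban's block averaging (0.4) is intertwined, once and iterated -/

section BlockAvg

open BlockAveraging

variable {F : T3Family} {m K j m' K' j' : ℕ} {G : Type*} [GaugeGroup G] (ℰ : LoopAverage G)

omit ℰ in
/-- The straight transporters `U(c)` (`AveragingRT.axialAvg`) correspond. [cite: Balaban1987RG1, (0.4) p.253] -/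
theorem axialAvg_fieldShift (h₀ : (F.PP m K).sitesPerDir j = (F.PP m' K').sitesPerDir j')
    (h₁ : (F.PP m K).sitesPerDir (j + 1) = (F.PP m' K').sitesPerDir (j' + 1)) (V : GaugeField (F.PP m' K') j' G)
    (c : PBond (F.PP m K) (j + 1)) :
    AveragingRT.axialAvg (fieldShift h₀ V) c = AveragingRT.axialAvg V (bondShift h₁ c) := by
  rw [axialAvg_eq_holAt_walk, axialAvg_eq_holAt_walk, holAt_fieldShift, ← walk_siteShift, siteShift_emb h₀ h₁]
  rfl

omit ℰ in
/-- The loop variables `U(Γ ∪ [x,x′] ∪ (−Γ′) ∪ (−c))` of (0.4) (`BlockAveraging.loopHol`) correspond, index by index. [cite: Balaban1987RG1, (0.4) p.253] -/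
theorem loopHol_fieldShift (h₀ : (F.PP m K).sitesPerDir j = (F.PP m' K').sitesPerDir j')
    (h₁ : (F.PP m K).sitesPerDir (j + 1) = (F.PP m' K').sitesPerDir (j' + 1)) (V : GaugeField (F.PP m' K') j' G)
    (c : PBond (F.PP m K) (j + 1)) (i : Idx (F.PP m K)) :
    loopHol (fieldShift h₀ V) c i = loopHol V (bondShift h₁ c) i := by
  unfold loopHol
  rw [holAt_fieldShift, ← walk_siteShift, siteShift_emb h₀ h₁]
  rfl

/-- The small-field domain of (0.4) is transported. [cite: Balaban1987RG1, (0.4) p.253] -/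
theorem small_fieldShift_iff (h₀ : (F.PP m K).sitesPerDir j = (F.PP m' K').sitesPerDir j')
    (h₁ : (F.PP m K).sitesPerDir (j + 1) = (F.PP m' K').sitesPerDir (j' + 1)) (V : GaugeField (F.PP m' K') j' G)
    (c : PBond (F.PP m K) (j + 1)) :
    BlockAveraging.Small ℰ (fieldShift h₀ V) c ↔ BlockAveraging.Small ℰ V (bondShift h₁ c) := by
  have hl : loopHol (fieldShift h₀ V) c = loopHol V (bondShift h₁ c) := funext (loopHol_fieldShift h₀ h₁ V c)
  unfold BlockAveraging.Small
  rw [hl]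
  exact Iff.rfl

/-- The correction factor of (0.4) corresponds. [cite: Balaban1987RG1, (0.4) p.253] -/
theorem corr_fieldShift (h₀ : (F.PP m K).sitesPerDir j = (F.PP m' K').sitesPerDir j')
    (h₁ : (F.PP m K).sitesPerDir (j + 1) = (F.PP m' K').sitesPerDir (j' + 1)) (V : GaugeField (F.PP m' K') j' G)
    (c : PBond (F.PP m K) (j + 1)) :
    corr ℰ (fieldShift h₀ V) c = corr ℰ V (bondShift h₁ c) := by
  have hl : loopHol (fieldShift h₀ V) c = loopHol V (bondShift h₁ c) := funext (loopHol_fieldShift h₀ h₁ V c)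
  unfold corr BlockAveraging.Small
  rw [hl]
  rfl

/-- The total (0.4)-shaped averaging map corresponds: `avgFun ℰ (fieldShift h₀ V) = fieldShift h₁ (avgFun ℰ V)`. [cite: Balaban1987RG1, (0.4) p.253] -/
theorem avgFun_fieldShift (h₀ : (F.PP m K).sitesPerDir j = (F.PP m' K').sitesPerDir j')
    (h₁ : (F.PP m K).sitesPerDir (j + 1) = (F.PP m' K').sitesPerDir (j' + 1)) (V : GaugeField (F.PP m' K') j' G) :
    avgFun ℰ (fieldShift h₀ V) = fieldShift h₁ (avgFun ℰ V) := by
  funext c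
  show corr ℰ _ c * AveragingRT.axialAvg _ c = corr ℰ V (bondShift h₁ c) * AveragingRT.axialAvg V (bondShift h₁ c)
  rw [corr_fieldShift ℰ h₀ h₁, axialAvg_fieldShift h₀ h₁]

/-- **BAŁABAN'S BLOCK AVERAGING (0.4) IS ONE MAP ON THE TWO TOWERS**: for every small-loop average `ℰ` and every pair of matched
level pairs, `(blockAvg ℰ).avg (fieldShift h₀ V) = fieldShift h₁ ((blockAvg ℰ).avg V)`. [cite: Balaban1987RG1, (0.4) p.253] -/
theorem blockAvg_fieldShift (h₀ : (F.PP m K).sitesPerDir j = (F.PP m' K').sitesPerDir j')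
    (h₁ : (F.PP m K).sitesPerDir (j + 1) = (F.PP m' K').sitesPerDir (j' + 1)) (V : GaugeField (F.PP m' K') j' G) :
    (blockAvg ℰ).avg (fieldShift h₀ V) = fieldShift h₁ ((blockAvg ℰ).avg V) := by
  simp only [blockAvg_avg]
  exact avgFun_fieldShift ℰ h₀ h₁ V

/-- **THE ITERATED AVERAGING OF TWO TOWERS WITH ALL LEVELS MATCHED** (`m + K = m′ + K′`): `k` (0.4)-averagings from the finest level
of the tower `(m, K)` of a configuration read from the tower `(m′, K′)` are its `k` averagings there, read at level `k`
([Balaban1987RG1] (0.11): `Ū^k = M^k(U)`). [cite: Balaban1987RG1, (0.11) p.253] -/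
theorem iter_fieldShift (hmK : m + K = m' + K') :
    ∀ (k : ℕ) (V : GaugeField (F.PP m' K') 0 G),
      Averaging.iter (fun i => blockAvg (P := F.PP m K) (j := i) ℰ) k
          (fieldShift (F.sitesPerDir_eq (m := m) (K := K) (j := 0) (m' := m') (K' := K') (j' := 0) (by omega)) V) =
        fieldShift (F.sitesPerDir_eq (m := m) (K := K) (j := k) (m' := m') (K' := K') (j' := k) (by omega))
          (Averaging.iter (fun i => blockAvg (P := F.PP m' K') (j := i) ℰ) k V)
  | 0, _ => rfl
  | k + 1, V => by
    show (blockAvg ℰ).avg (Averaging.iter (fun i => blockAvg (P := F.PP m K) (j := i) ℰ) k (fieldShift _ V)) =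
      fieldShift _ ((blockAvg ℰ).avg (Averaging.iter (fun i => blockAvg (P := F.PP m' K') (j := i) ℰ) k V))
    rw [iter_fieldShift hmK k V]
    exact blockAvg_fieldShift ℰ _ _ _

/-- **THE ITERATED AVERAGING FROM AN INTERMEDIATE LEVEL**: `n` (0.4)-averagings from level `k₀` of the tower `(m, K)` are `n`
averagings from the finest level of the shorter tower `(m₂, K₂)` whose level `i` is level `k₀ + i` of the first
(`m + K = m₂ + K₂ + k₀`), read through the identifications (`T4AvgSensitivity.iterFrom`). [cite: Balaban1987RG1, (0.11) p.253] -/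
theorem iterFrom_fieldShift {m₂ K₂ k₀ : ℕ} (hmK : m + K = m₂ + K₂ + k₀) :
    ∀ (n : ℕ) (W : GaugeField (F.PP m K) k₀ G),
      fieldShift (F.sitesPerDir_eq (m := m₂) (K := K₂) (j := n) (m' := m) (K' := K) (j' := k₀ + n) (by omega))
          (T4AvgSensitivity.iterFrom (fun i => blockAvg (P := F.PP m K) (j := i) ℰ) k₀ n W) =
        Averaging.iter (fun i => blockAvg (P := F.PP m₂ K₂) (j := i) ℰ) n
          (fieldShift (F.sitesPerDir_eq (m := m₂) (K := K₂) (j := 0) (m' := m) (K' := K) (j' := k₀) (by omega)) W)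
  | 0, _ => rfl
  | n + 1, W => by
    show fieldShift _ ((blockAvg ℰ).avg (T4AvgSensitivity.iterFrom (fun i => blockAvg (P := F.PP m K) (j := i) ℰ) k₀ n W)) =
      (blockAvg ℰ).avg (Averaging.iter (fun i => blockAvg (P := F.PP m₂ K₂) (j := i) ℰ) n (fieldShift _ W))
    rw [← iterFrom_fieldShift hmK n W]
    exact (blockAvg_fieldShift ℰ _ _ _).symm

end BlockAvg

/-! ## §5 The unit map of a d = 3 family and the factorisation of the node's observables through the unit field -/

section Unit

variable (F : T3Family) {G : Type*}

/-- **THE UNIT MAP**: the unit-lattice configurations of the `K`-th approximation read on the labels `USite = Site (F.P 0) 0`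
(`fieldShift` along `T3Family.sitesPerDir_unit`; its site map is `T3Family.toLevel K`). [folklore] -/
def unitShift (K : ℕ) : GaugeField (F.P K) K G → GaugeField (F.P 0) 0 G :=
  fieldShift (F.sitesPerDir_unit K)

/-- [cite: Balaban1987RG1, (0.1) p.251] -/
theorem unitShift_eq (K : ℕ) :
    (unitShift F K : GaugeField (F.P K) K G → GaugeField (F.P 0) 0 G) = fieldShift (F.sitesPerDir_unit K) :=
  rfl

/-- `unitShift 0` is the identity. [cite: Balaban1987RG1, (0.1) p.251] -/
theorem unitShift_zero (V : GaugeField (F.P 0) 0 G) : unitShift F 0 V = V :=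
  fieldShift_refl _ V

section Meas

variable [MeasurableSpace G]

/-- `unitShift` is measurable. [cite: Balaban1985Averaging, (10) p.19] -/
theorem measurable_unitShift (K : ℕ) : Measurable (unitShift F K : GaugeField (F.P K) K G → GaugeField (F.P 0) 0 G) :=
  measurable_fieldShift _

variable [GaugeGroup G] [HaarData G]

/-- `unitShift` preserves the product Haar measures. [cite: Balaban1985Averaging, (10) p.19] -/
theorem measurePreserving_unitShift (K : ℕ) :
    MeasurePreserving (unitShift F K : GaugeField (F.P K) K G → GaugeField (F.P 0) 0 G)
      (fieldMeasure (F.P K) K G) (fieldMeasure (F.P 0) 0 G) :=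
  measurePreserving_fieldShift _

end Meas

variable [GaugeGroup G]

/-- **THE UNIT OBSERVABLE IS APPROXIMATION-INDEPENDENT**: the loop variable of `C` at the unit level of the `K`-th approximation is
the loop variable of `C` at level `0` of the configuration read on `USite` (the `W` of a `T4VarianceMatching.UnitFactorisation`,
`K`-independent). [cite: Balaban1987RG1, (0.2)/(0.4) p.252] -/
theorem loopAt_unitShift (K : ℕ) (V : GaugeField (F.P K) K G) (C : UWord3 F) :
    loopAt (unitShift F K V) (C.atLevel 0) = loopAt V (C.atLevel K) :=
  loopAt_fieldShift_atLevel _ V C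

/-- **THE NODE'S OBSERVABLES FACTOR THROUGH THE UNIT FIELD**: `avgObs ℰ K C U = W_C(unitShift K (avg^K U))` with the
`K`-INDEPENDENT unit observable `W_C(u) = loopAt u (C.atLevel 0)` ([Balaban1987RG1] (0.4) iterated `K` times, then the loop variable
read on `T₁`). [cite: Balaban1987RG1, (0.2)/(0.4) p.252] -/
theorem _root_.Literature.MathematicalPhysics.QuantumFieldTheory.Balaban1983to89.T3ContinuumYM3Torus.T3Family.avgObs_eq_loopAt_unitShift
    (ℰ : LoopAverage G) (K : ℕ) (C : ULoop3 F) (U : GaugeField (F.P K) 0 G) :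
    F.avgObs ℰ K C U =
      loopAt (unitShift F K (Averaging.iter (fun j => BlockAveraging.blockAvg (P := F.P K) (j := j) ℰ) K U))
        (C.1.atLevel 0) := by
  rw [loopAt_unitShift]
  rfl

end Unit

end Literature.MathematicalPhysics.QuantumFieldTheory.Balaban1983to89.T3LevelShift

end
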